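import Literature.NumberTheory.Automorphic.CDTTheorem712
import Literature.NumberTheory.EllipticCurves.ModFiveCongruenceHesseFamily
import Literature.NumberTheory.EllipticCurves.GaloisActionProofs
import Literature.NumberTheory.GaloisRepresentations.AbsGaloisGroup
import HarnessLib

/-!
# stub-ideation k3 · GENERATION 12 (home FAMILY 3 — probe the extremes) — `stub_switch`, crux `FreyModularity`

**F1 BY RIGIDITY ALONG THE FISHER SEGMENT — typed helper lemmas.**
Namespace `…Cruxes.FreyModularity.StubSwitchK3g12`.  Companion of `STUB-IDEAS-stub_switch-3.md`.

STATE OF PLAY.  All three roads (k1-g12, k2-g10, k3-g11) close `stub_switch = CDT_three_five_switch`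
modulo ONE open input, the tree NAMED FACT
`F1 := HesseFamilyFive.thm132_geomTorsionFive_of_hesseFamily` (Fisher 2012, Thm 13.2 (i), `n = 5`):
g11 `CDT_three_five_switch_of_thm132 : F1 → CDT_three_five_switch` is kernel-checked (0 sorries).
So the stub IS F1, and this generation attacks F1 itself.

THE MOVE (Family 3: perturb from the solved extreme `t = 0` to `t = 1`).  Fix `c₄ c₆ l m : ℚ`, a torsor
point `v = (a,b) ∈ ℚ̄²` with `(c₄^{Kl}, c₆^{Kl})(v) = (c₄, c₆)` (g10 `exists_torsorPoint`, PROVED) and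
`w := M_v(l,m)` (Fisher L. 8.4: `c₄^{Kl}(w) = 𝔠₄(l,m)`, `c₆^{Kl}(w) = 𝔠₆(l,m)`).  The SEGMENT
`v_t := (1−t)v + t w = M_v(1−t+tl, tm)` has RATIONAL invariants for `t ∈ ℚ`, so every good `t`
(`D^{Kl}(v_t) ≠ 0`, cofinitely many) gives a `ℚ`-curve `E_t`, with `E_0 ≅ E`, `E_1 ≅ E_{l,m}`.  Klein's
sections `s_p(x) = (X_x, Y_x)(ζ, p)` (`x ∈ 𝔽₅² ∖ 0`; k2-g10's table, rescaled to INTEGER coefficients)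
are a bijection `𝔽₅² ∖ 0 → E_p[5] ∖ 0` at every torsor point `p` (24 on-curve + 48 tangent + 78
non-degeneracy certificates, each a one-line `linear_combination _ * hz`, kit-emitted; `#E[5] = 25` is
the tree theorem `card_torsionPoints_eq_sq_holds`).  RIGIDITY: for fixed `σ ∈ Γ_ℚ` and label `x` the
relation `σ • s_{v_t}(x) = s_{v_t}(y)` is a POLYNOMIAL IDENTITY IN `t`; it holds for some `y` at each of
infinitely many good rational `t`, hence (pigeonhole + `Polynomial.eq_of_infinite_eval_eq`) for ONE `y`
identically — the Galois relabelling `A_σ` is the same at `v` and at `w`.  The same engine applied to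
the denominator-cleared chord identities makes the label of `s(x)+s(y)` constant in `t`, so
`e := s_v ∘ s_w⁻¹` is ADDITIVE.  Hence `E_w[5] ≃ E_v[5]` `Γ_ℚ`-equivariantly: F1.  No Tschirnhaus
transfer (k2 H3: 313/513-monomial `NR/NS`), no H4, no chord certificates, no `2I ⊂ SL₂(ℚ̄)` enumeration.

CONTENTS.  §0 carriers (verbatim g10) · §1 the ENGINE `rigidity_engine` (PROVED) · §2 the section-table
INTERFACE `SectionTable` (a polynomial law, natural in the ring) + its certificate axioms `Certified`
+ the CONSTRUCTION statement `table_certified` (k2's table ×(25,125), kit certs) · §3 Klein models,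
`level_structure` (L1) · §4 the segment, `good_cofinite`, `galois_relabel_rigid` (L2), `chord_rigid`
(L3), `congr_of_rigidity` (L4) · §5 Fisher instantiation: `L84C6` (open, M−), `segmentFrame_fisher`,
`thm132_of_rigidity`, `stub_switch_of_rigidity`.  `sorry` only in the helper lemmas listed in the .md.
-/

set_option linter.dupNamespace false
set_option linter.unusedVariables false

namespace Summit.ABC.ABC.Cruxes.FreyModularity.StubSwitchK3g12

open Literature.NumberTheory.EllipticCurves Literature.NumberTheory.EllipticCurves.HesseFamilyFive
open Literature.NumberTheory.Automorphic Literature.NumberTheory.Automorphic.BCDT WeierstrassCurve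
open Polynomial

local notation "𝕃" => AlgebraicClosure ℚ

/-! ## §0 Carriers (verbatim from k3-g10; proofs verbatim) -/

section Klein
variable {R : Type*} [CommRing R]

def kD (a b : R) : R := a ^ 11 * b - 11 * a ^ 6 * b ^ 6 - a * b ^ 11
def kDa (a b : R) : R := 11 * a ^ 10 * b - 66 * a ^ 5 * b ^ 6 - b ^ 11
def kDb (a b : R) : R := a ^ 11 - 66 * a ^ 6 * b ^ 5 - 11 * a * b ^ 10
def kC4 (a b : R) : R :=
  a ^ 20 + 228 * a ^ 15 * b ^ 5 + 494 * a ^ 10 * b ^ 10 - 228 * a ^ 5 * b ^ 15 + b ^ 20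
def kC6 (a b : R) : R :=
  -a ^ 30 + 522 * a ^ 25 * b ^ 5 + 10005 * a ^ 20 * b ^ 10 + 10005 * a ^ 10 * b ^ 20
    - 522 * a ^ 5 * b ^ 25 - b ^ 30
/-- Fisher's `M_v(λ,μ) = (λa − μ∂_bD, λb + μ∂_aD)` (Lemma 8.4). -/
def Mv1 (a b l m : R) : R := l * a - m * kDb a b
def Mv2 (a b l m : R) : R := l * b + m * kDa a b

set_option maxHeartbeats 4000000 in
theorem klein_syzygy (a b : R) : kC4 a b ^ 3 - kC6 a b ^ 2 = 1728 * kD a b ^ 5 := by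
  simp only [kD, kC4, kC6]; ring

theorem map_kC4 {S : Type*} [CommRing S] (f : R →+* S) (a b : R) :
    f (kC4 a b) = kC4 (f a) (f b) := by
  simp only [kC4, map_add, map_sub, map_mul, map_pow, map_ofNat]

theorem map_kD {S : Type*} [CommRing S] (f : R →+* S) (a b : R) :
    f (kD a b) = kD (f a) (f b) := by
  simp only [kD, map_sub, map_mul, map_pow, map_ofNat]

theorem map_kC6 {S : Type*} [CommRing S] (f : R →+* S) (a b : R) :
    f (kC6 a b) = kC6 (f a) (f b) := by
  simp only [kC6, map_add, map_sub, map_neg, map_mul, map_pow, map_ofNat]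

/-- The segment is Fisher's pencil: `(1−t)·v + t·M_v(l,m) = M_v(1−t+tl, tm)` (both coordinates). -/
theorem seg_eq_Mv (a b l m t : R) :
    (1 - t) * a + t * Mv1 a b l m = Mv1 a b (1 - t + t * l) (t * m) ∧
    (1 - t) * b + t * Mv2 a b l m = Mv2 a b (1 - t + t * l) (t * m) := by
  constructor <;> simp only [Mv1, Mv2] <;> ring

end Klein

/-! ## §1 THE ENGINE — rigidity by pigeonhole (PROVED, pure Mathlib)

If finitely many candidate identities between polynomials are such that at each point of an infinite
set SOME candidate holds, then ONE candidate holds identically. -/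

theorem rigidity_engine {L : Type*} [CommRing L] [IsDomain L] {Λ : Type*} [Finite Λ] {ι : Type*}
    (S : Set L) (hS : S.Infinite) (P : ι → L[X]) (Q : Λ → ι → L[X])
    (h : ∀ t ∈ S, ∃ y, ∀ i, (P i).eval t = (Q y i).eval t) : ∃ y, ∀ i, P i = Q y i := by
  classical
  haveI : Infinite S := hS.to_subtype
  choose f hf using fun t : S => h t.1 t.2
  obtain ⟨y, hy⟩ := Finite.exists_infinite_fiber f
  refine ⟨y, fun i => Polynomial.eq_of_infinite_eval_eq (P i) (Q y i) ?_⟩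
  have hinf : Set.Infinite (Subtype.val '' (f ⁻¹' {y} : Set S)) :=
    (Set.infinite_coe_iff.mp hy).image Subtype.val_injective.injOn
  refine hinf.mono ?_
  rintro _ ⟨t, ht, rfl⟩
  have h1 := hf t i
  rw [Set.mem_preimage, Set.mem_singleton_iff] at ht
  rw [ht] at h1
  exact h1

/-! ## §2 THE INTERFACE — a section table is a pair of polynomial laws; its certificates are axioms;
its EXISTENCE (`table_certified`) is a separate construction statement (k2-g10's table, rescaled). -/

/-- Klein's level-`5` section table, abstractly: for each label `x ∈ 𝔽₅²` two polynomial laws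
`X_x, Y_x : R³ → R` (arguments `ζ, a, b`), natural in the commutative ring `R`.  Naturality is what
makes "`σ •`", "evaluate at `t`" and "coefficients in `ℚ̄[T]`" commute with the table. -/
structure SectionTable where
  X : ZMod 5 × ZMod 5 → ∀ (R : Type) [CommRing R], R → R → R → R
  Y : ZMod 5 × ZMod 5 → ∀ (R : Type) [CommRing R], R → R → R → R
  map_X : ∀ (x : ZMod 5 × ZMod 5) (R S : Type) [CommRing R] [CommRing S] (φ : R →+* S)
    (z a b : R), φ (X x R z a b) = X x S (φ z) (φ a) (φ b)
  map_Y : ∀ (x : ZMod 5 × ZMod 5) (R S : Type) [CommRing R] [CommRing S] (φ : R →+* S)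
    (z a b : R), φ (Y x R z a b) = Y x S (φ z) (φ a) (φ b)

/-- The CERTIFICATE AXIOMS of a section table, for the INTEGER model
`E⁽⁵⁾_{a,b} : y² = x³ − 27·5⁴·c₄^{Kl}(a,b)·x − 54·5⁶·c₆^{Kl}(a,b)` (k2-g10's table has all denominators
equal to `5`; `(X, Y) := (25·sX, 125·sY)` is integral and lies on `E⁽⁵⁾`).  Each field is a finite list
of identities modulo `Φ₅(z)`, kit-emitted as `simp only [defs]; linear_combination e * hz`
(k2 pattern, samples PROVED in `STUB_IDEAS_stub_switch_2g10_Klein5.lean` §3):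
`sign` 2×24 (literal), `onCurve` 24, `dblX/dblY` 24+24 (tangent, denominators cleared),
`ndgX` 66 (`(X_x − X_y)·cof = 5^k·D²`), `ndgY` 12 (`Y_x·cof = 5^k·D²`). -/
structure SectionTable.Certified (T : SectionTable) : Prop where
  sign_X : ∀ (x : ZMod 5 × ZMod 5) (R : Type) [CommRing R] (z a b : R),
    T.X (-x) R z a b = T.X x R z a b
  sign_Y : ∀ (x : ZMod 5 × ZMod 5) (R : Type) [CommRing R] (z a b : R),
    T.Y (-x) R z a b = -T.Y x R z a b
  onCurve : ∀ (F : Type) [Field F] [CharZero F] (z a b : F), z ^ 4 + z ^ 3 + z ^ 2 + z + 1 = 0 →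
    ∀ x : ZMod 5 × ZMod 5, x ≠ 0 →
      T.Y x F z a b ^ 2 =
        T.X x F z a b ^ 3 - 27 * 5 ^ 4 * kC4 a b * T.X x F z a b - 54 * 5 ^ 6 * kC6 a b
  dblX : ∀ (F : Type) [Field F] [CharZero F] (z a b : F), z ^ 4 + z ^ 3 + z ^ 2 + z + 1 = 0 →
    ∀ x : ZMod 5 × ZMod 5, x ≠ 0 →
      (T.X (x + x) F z a b + 2 * T.X x F z a b) * (2 * T.Y x F z a b) ^ 2 =
        (3 * T.X x F z a b ^ 2 - 27 * 5 ^ 4 * kC4 a b) ^ 2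
  dblY : ∀ (F : Type) [Field F] [CharZero F] (z a b : F), z ^ 4 + z ^ 3 + z ^ 2 + z + 1 = 0 →
    ∀ x : ZMod 5 × ZMod 5, x ≠ 0 →
      (T.Y (x + x) F z a b + T.Y x F z a b) * (2 * T.Y x F z a b) =
        (3 * T.X x F z a b ^ 2 - 27 * 5 ^ 4 * kC4 a b) * (T.X x F z a b - T.X (x + x) F z a b)
  ndgX : ∀ (F : Type) [Field F] [CharZero F] (z a b : F), z ^ 4 + z ^ 3 + z ^ 2 + z + 1 = 0 →
    kD a b ≠ 0 → ∀ x y : ZMod 5 × ZMod 5, x ≠ 0 → y ≠ 0 → x ≠ y → x ≠ -y →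
      T.X x F z a b ≠ T.X y F z a b
  ndgY : ∀ (F : Type) [Field F] [CharZero F] (z a b : F), z ^ 4 + z ^ 3 + z ^ 2 + z + 1 = 0 →
    kD a b ≠ 0 → ∀ x : ZMod 5 × ZMod 5, x ≠ 0 → T.Y x F z a b ≠ 0

/-- **P0 · table_certified (CONSTRUCTION; XS per certificate, ~200 kit-emitted one-liners).**
k2-g10's table `sX_i_j, sY_i_j` multiplied by `25, 125` (all its denominators are `5`) defines a
`SectionTable` over every commutative ring (naturality: `simp only [defs, map_add, map_mul, map_pow,
map_neg, map_sub, map_ofNat]`, pattern `map_kC4`), and the kit certificates (j345479/j345488/j345492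
regenerated in the integer normalisation) prove `Certified`. -/
theorem table_certified : ∃ T : SectionTable, T.Certified := by
  sorry

/-! ## §3 Klein models and the level structure at ONE torsor point (L1) -/

/-- The integer `c₄c₆`-model `y² = x³ − 27·5⁴·A·x − 54·5⁶·B` (`= ⟨5⁻¹,0,0,0⟩ • (y² = x³ − 27Ax − 54B)`,
tree `scale_smul_short 5`). -/
abbrev sbase (A B : ℚ) : WeierstrassCurve ℚ := ⟨0, 0, 0, -(27 * 5 ^ 4) * A, -(54 * 5 ^ 6) * B⟩

/-- `W/ℚ` is the integer `c₄c₆`-model attached to the torsor point `(a,b) ∈ ℚ̄²`. -/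
structure IsKleinModel (W : WeierstrassCurve ℚ) (a b : 𝕃) : Prop where
  ha₁ : W.a₁ = 0
  ha₂ : W.a₂ = 0
  ha₃ : W.a₃ = 0
  ha₄ : ((W.a₄ : ℚ) : 𝕃) = -(27 * 5 ^ 4) * kC4 a b
  ha₆ : ((W.a₆ : ℚ) : 𝕃) = -(54 * 5 ^ 6) * kC6 a b

/-- **L1a · secPt_nonsingular (S).** A table point is a nonsingular point of `W/ℚ̄`
(`onCurve` + Mathlib `Affine.equation_iff_nonsingular` for elliptic `W`). -/
theorem secPt_nonsingular (T : SectionTable) (hT : T.Certified) (W : WeierstrassCurve ℚ)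
    [W.IsElliptic] {z a b : 𝕃} (hz : z ^ 4 + z ^ 3 + z ^ 2 + z + 1 = 0) (hW : IsKleinModel W a b)
    (x : ZMod 5 × ZMod 5) (hx : x ≠ 0) :
    (W.baseChange 𝕃).toAffine.Nonsingular (T.X x 𝕃 z a b) (T.Y x 𝕃 z a b) := by
  sorry

/-- **L1 · level_structure (M).** At a torsor point `p = (a,b)` with `D^{Kl}(p) ≠ 0` the table is a
bijection `s : 𝔽₅² → W[5]` (`0 ↦ O`) with `s(−x) = −s(x)` and `s(2x) = 2·s(x)`.
Proof: points are on the curve (L1a); `s(2x) = 2 s(x)` from `dblX/dblY` + Mathlib doubling formula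
(`Y_x ≠ 0` by `ndgY`); `s(−x) = −s(x)` from `sign`; hence `5·s(x) = s(x) + s(4x) = s(x) + s(−x) = 0`;
injectivity on `𝔽₅² ∖ 0` from `ndgX` (+ `sign_Y`, `ndgY` for `y = −x`), values `≠ O`; so `24`
distinct non-zero `5`-torsion points, and `#W[5] = 25` (`card_torsionPoints_eq_sq_holds W ℚ̄
(n := 5)`) gives bijectivity. -/
theorem level_structure (T : SectionTable) (hT : T.Certified) (W : WeierstrassCurve ℚ)
    [W.IsElliptic] {z a b : 𝕃} (hz : z ^ 4 + z ^ 3 + z ^ 2 + z + 1 = 0) (hW : IsKleinModel W a b)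
    (hD : kD a b ≠ 0) :
    ∃ s : ZMod 5 × ZMod 5 → W.geomTorsion 5,
      Function.Bijective s ∧ (∀ x, s (-x) = -s x) ∧ (∀ x, s (x + x) = s x + s x) ∧
      ∀ (x : ZMod 5 × ZMod 5) (hx : x ≠ 0),
        ((s x : W.geomTorsion 5) : geomPoints W) =
          (Affine.Point.some (T.X x 𝕃 z a b) (T.Y x 𝕃 z a b) (secPt_nonsingular T hT W hz hW x hx) :
            (W.baseChange 𝕃).toAffine.Point) := by
  sorry

/-! ## §4 The segment and the two rigidity lemmas (L2, L3); the abstract assembly (L4) -/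

/-- The segment coordinate `(1 − t)·a + t·a'` at a RATIONAL time `t`. -/
noncomputable def seg (a a' : 𝕃) (t : ℚ) : 𝕃 := (1 - (t : 𝕃)) * a + (t : 𝕃) * a'

@[simp] theorem seg_zero (a a' : 𝕃) : seg a a' 0 = a := by simp [seg]
@[simp] theorem seg_one (a a' : 𝕃) : seg a a' 1 = a' := by simp [seg]

/-- `σ ∈ Aut(ℚ̄/ℚ)` acts on the segment through its endpoints (it fixes `t ∈ ℚ`). -/
theorem smul_seg (σ : 𝕃 ≃ₐ[ℚ] 𝕃) (a a' : 𝕃) (t : ℚ) : σ (seg a a' t) = seg (σ a) (σ a') t := by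
  simp [seg, map_add, map_mul, map_sub]

/-- A table coordinate along the segment, as an honest polynomial in `t` over `ℚ̄`. -/
noncomputable def segPoly (f : ∀ (R : Type) [CommRing R], R → R → R → R) (z a b a' b' : 𝕃) : 𝕃[X] :=
  f 𝕃[X] (C z) (C a + X * C (a' - a)) (C b + X * C (b' - b))

/-- Evaluating `segPoly` at a rational time gives the table coordinate at `v_t` (naturality under
`evalRingHom`).  With `smul_seg` and `map_X` for `σ`, this is all the engine needs. -/
theorem segPoly_eval_X (T : SectionTable) (x : ZMod 5 × ZMod 5) (z a b a' b' : 𝕃) (t : ℚ) :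
    (segPoly (T.X x) z a b a' b').eval (t : 𝕃) = T.X x 𝕃 z (seg a a' t) (seg b b' t) := by
  have h := T.map_X x 𝕃[X] 𝕃 (Polynomial.evalRingHom (t : 𝕃)) (C z) (C a + X * C (a' - a))
    (C b + X * C (b' - b))
  simp only [Polynomial.coe_evalRingHom, eval_C, eval_add, eval_mul, eval_X] at h
  rw [segPoly, h, seg, seg]
  congr 1 <;> ring

theorem segPoly_eval_Y (T : SectionTable) (x : ZMod 5 × ZMod 5) (z a b a' b' : 𝕃) (t : ℚ) :
    (segPoly (T.Y x) z a b a' b').eval (t : 𝕃) = T.Y x 𝕃 z (seg a a' t) (seg b b' t) := by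
  have h := T.map_Y x 𝕃[X] 𝕃 (Polynomial.evalRingHom (t : 𝕃)) (C z) (C a + X * C (a' - a))
    (C b + X * C (b' - b))
  simp only [Polynomial.coe_evalRingHom, eval_C, eval_add, eval_mul, eval_X] at h
  rw [segPoly, h, seg, seg]
  congr 1 <;> ring

/-- **S1 · good_cofinite (S).** Only finitely many rational times are bad: `t ↦ D^{Kl}(v_t)` is a
polynomial (`map_kD` into `ℚ̄[X]`), non-zero at `t = 0`. -/
theorem good_cofinite {a b : 𝕃} (a' b' : 𝕃) (hD : kD a b ≠ 0) :
    {t : ℚ | kD (seg a a' t) (seg b b' t) = 0}.Finite := by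
  classical
  set p : 𝕃[X] := kD (C a + X * C (a' - a)) (C b + X * C (b' - b)) with hp
  have hev : ∀ t : ℚ, p.eval (t : 𝕃) = kD (seg a a' t) (seg b b' t) := by
    intro t
    have h := map_kD (Polynomial.evalRingHom (t : 𝕃)) (C a + X * C (a' - a)) (C b + X * C (b' - b))
    simp only [Polynomial.coe_evalRingHom, eval_C, eval_add, eval_mul, eval_X] at h
    rw [hp, h, seg, seg]
    congr 1 <;> ring
  have hp0 : p ≠ 0 := by
    intro h0
    apply hD
    have h := hev 0
    rw [h0, eval_zero, seg_zero, seg_zero] at h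
    exact h.symm
  have hfin : ((p.roots.toFinset : Finset 𝕃) : Set 𝕃).Finite := Finset.finite_toSet _
  refine (hfin.preimage Rat.cast_injective.injOn).subset ?_
  intro t ht
  simp only [Set.mem_preimage, Finset.mem_coe]
  rw [Multiset.mem_toFinset, Polynomial.mem_roots hp0, Polynomial.IsRoot.def, hev]
  exact ht

/-- `σ` passes through the table (naturality with `φ = σ`). -/
theorem smul_table_X (T : SectionTable) (σ : 𝕃 ≃ₐ[ℚ] 𝕃) (x : ZMod 5 × ZMod 5) (z u v : 𝕃) :
    σ (T.X x 𝕃 z u v) = T.X x 𝕃 (σ z) (σ u) (σ v) := by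
  have h := T.map_X x 𝕃 𝕃 (σ : 𝕃 →+* 𝕃) z u v
  simpa using h

theorem smul_table_Y (T : SectionTable) (σ : 𝕃 ≃ₐ[ℚ] 𝕃) (x : ZMod 5 × ZMod 5) (z u v : 𝕃) :
    σ (T.Y x 𝕃 z u v) = T.Y x 𝕃 (σ z) (σ u) (σ v) := by
  have h := T.map_Y x 𝕃 𝕃 (σ : 𝕃 →+* 𝕃) z u v
  simpa using h

/-- **L2b · relabel_rigid_of_pointwise (PROVED): the algebraic half of L2.** If at each time of an
infinite set of rationals SOME non-zero label `y` realises `σ(X_x, Y_x) = (X_y, Y_y)` at `(ζ, v_t)`,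
then ONE label does so at every rational time (`rigidity_engine` on `ℚ̄[X]`, `ι = Bool`). -/
theorem relabel_rigid_of_pointwise (T : SectionTable) {z a b a' b' : 𝕃} (σ : 𝕃 ≃ₐ[ℚ] 𝕃)
    (x : ZMod 5 × ZMod 5) (S : Set ℚ) (hS : S.Infinite)
    (h : ∀ t ∈ S, ∃ y : ZMod 5 × ZMod 5, y ≠ 0 ∧
      σ (T.X x 𝕃 z (seg a a' t) (seg b b' t)) = T.X y 𝕃 z (seg a a' t) (seg b b' t) ∧
      σ (T.Y x 𝕃 z (seg a a' t) (seg b b' t)) = T.Y y 𝕃 z (seg a a' t) (seg b b' t)) :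
    ∃ y : ZMod 5 × ZMod 5, y ≠ 0 ∧ ∀ t : ℚ,
      σ (T.X x 𝕃 z (seg a a' t) (seg b b' t)) = T.X y 𝕃 z (seg a a' t) (seg b b' t) ∧
      σ (T.Y x 𝕃 z (seg a a' t) (seg b b' t)) = T.Y y 𝕃 z (seg a a' t) (seg b b' t) := by
  classical
  let P : Bool → 𝕃[X] := fun i =>
    cond i (segPoly (T.X x) (σ z) (σ a) (σ b) (σ a') (σ b'))
      (segPoly (T.Y x) (σ z) (σ a) (σ b) (σ a') (σ b'))
  let Q : {y : ZMod 5 × ZMod 5 // y ≠ 0} → Bool → 𝕃[X] := fun y i =>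
    cond i (segPoly (T.X y.1) z a b a' b') (segPoly (T.Y y.1) z a b a' b')
  have hS' : (((↑) : ℚ → 𝕃) '' S).Infinite := hS.image Rat.cast_injective.injOn
  have key : ∀ t' ∈ ((↑) : ℚ → 𝕃) '' S, ∃ y : {y : ZMod 5 × ZMod 5 // y ≠ 0},
      ∀ i, (P i).eval t' = (Q y i).eval t' := by
    rintro _ ⟨t, ht, rfl⟩
    obtain ⟨y, hy0, hX, hY⟩ := h t ht
    refine ⟨⟨y, hy0⟩, fun i => ?_⟩
    cases i
    · simp only [P, Q, cond_false, segPoly_eval_Y]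
      rw [← smul_seg, ← smul_seg, ← smul_table_Y]
      exact hY
    · simp only [P, Q, cond_true, segPoly_eval_X]
      rw [← smul_seg, ← smul_seg, ← smul_table_X]
      exact hX
  obtain ⟨y, hy⟩ := rigidity_engine _ hS' P Q key
  refine ⟨y.1, y.2, fun t => ⟨?_, ?_⟩⟩
  · have e := congrArg (Polynomial.eval (t : 𝕃)) (hy true)
    simp only [P, Q, cond_true, segPoly_eval_X] at e
    rw [smul_table_X, smul_seg, smul_seg]
    exact e
  · have e := congrArg (Polynomial.eval (t : 𝕃)) (hy false)
    simp only [P, Q, cond_false, segPoly_eval_Y] at e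
    rw [smul_table_Y, smul_seg, smul_seg]
    exact e

/-- The hypotheses of rigidity along a segment `v_t = (1−t)(a,b) + t(a',b')`: a primitive `5`-th root
`z`, a good start, and for every GOOD rational `t` a `ℚ`-MODEL `W_t` of the curve at `v_t`
(for Fisher's segment: `W_t = sbase (𝔠₄(1−t+tl, tm)) (𝔠₆(1−t+tl, tm))`, §5). -/
structure SegmentFrame (T : SectionTable) (z a b a' b' : 𝕃) : Prop where
  hz : z ^ 4 + z ^ 3 + z ^ 2 + z + 1 = 0
  hD : kD a b ≠ 0
  model : ∀ t : ℚ, kD (seg a a' t) (seg b b' t) ≠ 0 →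
    ∃ W : WeierstrassCurve ℚ, W.IsElliptic ∧ IsKleinModel W (seg a a' t) (seg b b' t)

/-- **L2a · relabel_pointwise (S/M, from L1).** At ONE good rational time `t`, `σ • s_t(x)` is again
a non-zero `5`-torsion point of the `ℚ`-curve `W_t` (`hF.model`; `smul_mem_torsionPoints`, `smul_def`,
`Affine.Point.map_some`, `smul_table_X/Y`), hence `= s_t(y)` for some label `y ≠ 0` by L1
(bijectivity).  This is the only place the `ℚ`-structure of `W_t` is used. -/
theorem relabel_pointwise (T : SectionTable) (hT : T.Certified) {z a b a' b' : 𝕃}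
    (hF : SegmentFrame T z a b a' b') (σ : 𝕃 ≃ₐ[ℚ] 𝕃) (x : ZMod 5 × ZMod 5) (hx : x ≠ 0)
    (t : ℚ) (ht : kD (seg a a' t) (seg b b' t) ≠ 0) :
    ∃ y : ZMod 5 × ZMod 5, y ≠ 0 ∧
      σ (T.X x 𝕃 z (seg a a' t) (seg b b' t)) = T.X y 𝕃 z (seg a a' t) (seg b b' t) ∧
      σ (T.Y x 𝕃 z (seg a a' t) (seg b b' t)) = T.Y y 𝕃 z (seg a a' t) (seg b b' t) := by
  sorry

/-- **L2 · galois_relabel_rigid (PROVED from L2a + L2b + S1).** For `σ ∈ Aut(ℚ̄/ℚ)` and a label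
`x ≠ 0` there is ONE label `y ≠ 0` with `σ(X_x, Y_x)(ζ, v_t) = (X_y, Y_y)(ζ, v_t)` for EVERY rational
`t` — in particular the Galois relabelling is the same permutation at `t = 0` and at `t = 1`. -/
theorem galois_relabel_rigid (T : SectionTable) (hT : T.Certified) {z a b a' b' : 𝕃}
    (hF : SegmentFrame T z a b a' b') (σ : 𝕃 ≃ₐ[ℚ] 𝕃) (x : ZMod 5 × ZMod 5) (hx : x ≠ 0) :
    ∃ y : ZMod 5 × ZMod 5, y ≠ 0 ∧ ∀ t : ℚ,
      σ (T.X x 𝕃 z (seg a a' t) (seg b b' t)) = T.X y 𝕃 z (seg a a' t) (seg b b' t) ∧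
      σ (T.Y x 𝕃 z (seg a a' t) (seg b b' t)) = T.Y y 𝕃 z (seg a a' t) (seg b b' t) := by
  have hS : ({t : ℚ | kD (seg a a' t) (seg b b' t) = 0}ᶜ).Infinite :=
    (good_cofinite a' b' hF.hD).infinite_compl
  exact relabel_rigid_of_pointwise T σ x _ hS (fun t ht => relabel_pointwise T hT hF σ x hx t ht)

/-- The chord law with denominators cleared (`P₃ = P₁ + P₂`, `x₁ ≠ x₂`, `a₁ = a₂ = a₃ = 0`):
`(x₃ + x₁ + x₂)(x₁ − x₂)² = (y₁ − y₂)²` and `(y₃ + y₁)(x₁ − x₂) = (y₁ − y₂)(x₁ − x₃)`. -/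
def ChordRel {R : Type*} [CommRing R] (x₁ y₁ x₂ y₂ x₃ y₃ : R) : Prop :=
  (x₃ + x₁ + x₂) * (x₁ - x₂) ^ 2 = (y₁ - y₂) ^ 2 ∧ (y₃ + y₁) * (x₁ - x₂) = (y₁ - y₂) * (x₁ - x₃)

/-- **S2 · add_eq_iff_chordRel (S).** For `x₁ ≠ x₂` on a short Weierstrass curve, `P₁ + P₂ = P₃` iff
`ChordRel` (Mathlib `Affine.Point.add_of_X_ne`, `addX`, `addY`, `slope_of_X_ne`; `field_simp`). -/
theorem add_eq_iff_chordRel {K : Type*} [Field K] [DecidableEq K] (E : WeierstrassCurve K) (h₁ : E.a₁ = 0)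
    (h₂ : E.a₂ = 0) (h₃ : E.a₃ = 0) {x₁ y₁ x₂ y₂ x₃ y₃ : K}
    (n₁ : E.toAffine.Nonsingular x₁ y₁) (n₂ : E.toAffine.Nonsingular x₂ y₂)
    (n₃ : E.toAffine.Nonsingular x₃ y₃) (hne : x₁ ≠ x₂) :
    Affine.Point.some x₁ y₁ n₁ + Affine.Point.some x₂ y₂ n₂ = Affine.Point.some x₃ y₃ n₃ ↔
      ChordRel x₁ y₁ x₂ y₂ x₃ y₃ := by
  sorry

/-- **L3a · chord_pointwise (S/M, from L1 + S2).** At ONE good rational time `t`, for labels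
`x, y ≠ 0`, `y ≠ ±x`: `s_t(x) + s_t(y) ∈ W_t[5]` is `≠ O` (L1 injective, `y ≠ −x`), so `= s_t(w)` with
`w ≠ 0`; and `X_x ≠ X_y` there (`ndgX`), so S2 turns the point identity into `ChordRel`. -/
theorem chord_pointwise (T : SectionTable) (hT : T.Certified) {z a b a' b' : 𝕃}
    (hF : SegmentFrame T z a b a' b') (x y : ZMod 5 × ZMod 5) (hx : x ≠ 0) (hy : y ≠ 0)
    (hxy : x ≠ y) (hxy' : x ≠ -y) (t : ℚ) (ht : kD (seg a a' t) (seg b b' t) ≠ 0) :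
    ∃ w : ZMod 5 × ZMod 5, w ≠ 0 ∧
      ChordRel (T.X x 𝕃 z (seg a a' t) (seg b b' t)) (T.Y x 𝕃 z (seg a a' t) (seg b b' t))
        (T.X y 𝕃 z (seg a a' t) (seg b b' t)) (T.Y y 𝕃 z (seg a a' t) (seg b b' t))
        (T.X w 𝕃 z (seg a a' t) (seg b b' t)) (T.Y w 𝕃 z (seg a a' t) (seg b b' t)) := by
  sorry

/-- **L3b · chord_rigid_of_pointwise (PROVED): the algebraic half of L3.** If at each time of an
infinite set of rationals SOME non-zero label `w` satisfies the cleared chord identities for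
`s(x) + s(y) = s(w)` at `(ζ, v_t)`, then ONE label does so at every rational time
(`rigidity_engine` with `P = 0`, `Q w =` the two defect polynomials in `ℚ̄[X]`). -/
theorem chord_rigid_of_pointwise (T : SectionTable) {z a b a' b' : 𝕃} (x y : ZMod 5 × ZMod 5)
    (S : Set ℚ) (hS : S.Infinite)
    (h : ∀ t ∈ S, ∃ w : ZMod 5 × ZMod 5, w ≠ 0 ∧
      ChordRel (T.X x 𝕃 z (seg a a' t) (seg b b' t)) (T.Y x 𝕃 z (seg a a' t) (seg b b' t))
        (T.X y 𝕃 z (seg a a' t) (seg b b' t)) (T.Y y 𝕃 z (seg a a' t) (seg b b' t))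
        (T.X w 𝕃 z (seg a a' t) (seg b b' t)) (T.Y w 𝕃 z (seg a a' t) (seg b b' t))) :
    ∃ w : ZMod 5 × ZMod 5, w ≠ 0 ∧ ∀ t : ℚ,
      ChordRel (T.X x 𝕃 z (seg a a' t) (seg b b' t)) (T.Y x 𝕃 z (seg a a' t) (seg b b' t))
        (T.X y 𝕃 z (seg a a' t) (seg b b' t)) (T.Y y 𝕃 z (seg a a' t) (seg b b' t))
        (T.X w 𝕃 z (seg a a' t) (seg b b' t)) (T.Y w 𝕃 z (seg a a' t) (seg b b' t)) := by
  classical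
  let PX : ZMod 5 × ZMod 5 → 𝕃[X] := fun u => segPoly (T.X u) z a b a' b'
  let PY : ZMod 5 × ZMod 5 → 𝕃[X] := fun u => segPoly (T.Y u) z a b a' b'
  let P : Bool → 𝕃[X] := fun _ => 0
  let Q : {w : ZMod 5 × ZMod 5 // w ≠ 0} → Bool → 𝕃[X] := fun w i =>
    cond i ((PX w.1 + PX x + PX y) * (PX x - PX y) ^ 2 - (PY x - PY y) ^ 2)
      ((PY w.1 + PY x) * (PX x - PX y) - (PY x - PY y) * (PX x - PX w.1))
  have hS' : (((↑) : ℚ → 𝕃) '' S).Infinite := hS.image Rat.cast_injective.injOn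
  have key : ∀ t' ∈ ((↑) : ℚ → 𝕃) '' S, ∃ w : {w : ZMod 5 × ZMod 5 // w ≠ 0},
      ∀ i, (P i).eval t' = (Q w i).eval t' := by
    rintro _ ⟨t, ht, rfl⟩
    obtain ⟨w, hw0, hC⟩ := h t ht
    obtain ⟨hC1, hC2⟩ := hC
    refine ⟨⟨w, hw0⟩, fun i => ?_⟩
    cases i
    · simp only [P, Q, PX, PY, cond_false, eval_zero, eval_sub, eval_mul, eval_add,
        segPoly_eval_X, segPoly_eval_Y]
      exact (sub_eq_zero.mpr hC2).symm
    · simp only [P, Q, PX, PY, cond_true, eval_zero, eval_sub, eval_mul, eval_add, eval_pow,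
        segPoly_eval_X, segPoly_eval_Y]
      exact (sub_eq_zero.mpr hC1).symm
  obtain ⟨w, hw⟩ := rigidity_engine _ hS' P Q key
  refine ⟨w.1, w.2, fun t => ⟨?_, ?_⟩⟩
  · have e := congrArg (Polynomial.eval (t : 𝕃)) (hw true)
    simp only [P, Q, PX, PY, cond_true, eval_zero, eval_sub, eval_mul, eval_add, eval_pow,
      segPoly_eval_X, segPoly_eval_Y] at e
    exact sub_eq_zero.mp e.symm
  · have e := congrArg (Polynomial.eval (t : 𝕃)) (hw false)
    simp only [P, Q, PX, PY, cond_false, eval_zero, eval_sub, eval_mul, eval_add,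
      segPoly_eval_X, segPoly_eval_Y] at e
    exact sub_eq_zero.mp e.symm

/-- **L3 · chord_rigid (PROVED from L3a + L3b + S1).** For labels `x, y ≠ 0`, `y ≠ ±x`, there is
ONE label `w ≠ 0` such that the cleared chord identities "`s(x) + s(y) = s(w)`" hold at `(ζ, v_t)`
for EVERY rational `t`: the addition table of the level structure is constant along the segment. -/
theorem chord_rigid (T : SectionTable) (hT : T.Certified) {z a b a' b' : 𝕃}
    (hF : SegmentFrame T z a b a' b') (x y : ZMod 5 × ZMod 5) (hx : x ≠ 0) (hy : y ≠ 0)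
    (hxy : x ≠ y) (hxy' : x ≠ -y) :
    ∃ w : ZMod 5 × ZMod 5, w ≠ 0 ∧ ∀ t : ℚ,
      ChordRel (T.X x 𝕃 z (seg a a' t) (seg b b' t)) (T.Y x 𝕃 z (seg a a' t) (seg b b' t))
        (T.X y 𝕃 z (seg a a' t) (seg b b' t)) (T.Y y 𝕃 z (seg a a' t) (seg b b' t))
        (T.X w 𝕃 z (seg a a' t) (seg b b' t)) (T.Y w 𝕃 z (seg a a' t) (seg b b' t)) := by
  have hS : ({t : ℚ | kD (seg a a' t) (seg b b' t) = 0}ᶜ).Infinite :=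
    (good_cofinite a' b' hF.hD).infinite_compl
  exact chord_rigid_of_pointwise T x y _ hS
    (fun t ht => chord_pointwise T hT hF x y hx hy hxy hxy' t ht)

/-- **L4 · congr_of_rigidity (M).** The ends of a framed segment are `5`-congruent.
Proof: L1 at `t = 0` (`W₀`, `s₀`) and `t = 1` (`W₁`, `s₁`); `e := s₀ ∘ s₁⁻¹ : W₁[5] → W₀[5]` is a
bijection with `e(O) = O`; ADDITIVE by cases — `Q = O`; `Q = −P` (`sign`, L1); `Q = P` (L1 doubling);
generic (`chord_rigid` at `t = 1` then `t = 0`, via S2 and `ndgX`); `Γ_ℚ`-EQUIVARIANT by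
`galois_relabel_rigid` at `t = 1` and `t = 0` (`Field.absoluteGaloisGroup.smul_def`, `smul_def`,
`Affine.Point.map_some`).  Package as `AddEquiv.ofBijective`. -/
theorem congr_of_rigidity (T : SectionTable) (hT : T.Certified) {z a b a' b' : 𝕃}
    (hF : SegmentFrame T z a b a' b') (W₀ W₁ : WeierstrassCurve ℚ) [W₀.IsElliptic] [W₁.IsElliptic]
    (h₀ : IsKleinModel W₀ a b) (h₁ : IsKleinModel W₁ a' b') (hD₁ : kD a' b' ≠ 0) :
    Congr W₁ W₀ := by
  sorry

/-! ## §5 Fisher's segment: instantiation and the assembly to F1 and to the stub -/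

/-- **L84-C6 (M−, OPEN; stated with `sorry` in k2-g10 §5, kit-exact j345205/j345479).** Fisher,
Lemma 8.4 for `𝔠₆`: `𝔠₆(l,m) = c₆^{Kl}(M_v(l,m))` when `(c₄,c₆) = (c₄^{Kl}, c₆^{Kl})(v)`, `D^{Kl}(v) ≠ 0`.
Route: `𝔠₆ = Jac(𝔇, 𝔠₄)/240` (tree def `C6`), chain rule through `M_v` (`det M_v = 12·D^{Kl}`), g10's
`klein_jacobian : Jac(D^{Kl}, c₄^{Kl}) = 20·c₆^{Kl}`, L84-D and L84-C4 (PROVED g9/g10) — exactly as g9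
proved L84-C4 from `klein_hessian`. [Fisher2012Hessian, Lemma 8.4] -/
def L84C6 : Prop :=
  ∀ (a b l m : 𝕃), kD a b ≠ 0 → C6 (kC4 a b) (kC6 a b) l m = kC6 (Mv1 a b l m) (Mv2 a b l m)

/-- L84-C4 over `ℚ̄` (PROVED in k3-g10 `lemma84_C4`, verbatim available; restated). -/
theorem lemma84_C4 (a b l m : 𝕃) (hD : kD a b ≠ 0) :
    C4 (kC4 a b) (kC6 a b) l m = kC4 (Mv1 a b l m) (Mv2 a b l m) := by
  sorry

/-- L84-D over `ℚ̄` (PROVED in k3-g9/g10 `lemma84_D` by `ring`, verbatim available; restated). -/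
theorem lemma84_D (a b l m : 𝕃) :
    D (kC4 a b) (kC6 a b) l m * kD a b = kD (Mv1 a b l m) (Mv2 a b l m) := by
  sorry

/-- T1 (PROVED in k3-g10 `exists_torsorPoint`, ~120 lines, verbatim available; restated). -/
theorem exists_torsorPoint (c₄ c₆ : 𝕃) (h : c₄ ^ 3 ≠ c₆ ^ 2) :
    ∃ a b : 𝕃, kC4 a b = c₄ ∧ kC6 a b = c₆ := by
  sorry

/-- **S3 · map_C4 / map_C6 (S).** Fisher's invariants commute with `ℚ → ℚ̄`
(`simp only [C4, C6, C4l, C4m, Dl, Dm, Dll, Dlm, Dmm, Dlll, Dllm, Dlmm, Dmmm, Rat.cast_div, …]`). -/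
theorem cast_C4 (c₄ c₆ l m : ℚ) :
    ((C4 c₄ c₆ l m : ℚ) : 𝕃) = C4 (c₄ : 𝕃) (c₆ : 𝕃) (l : 𝕃) (m : 𝕃) := by
  simp only [C4, Dll, Dlm, Dmm]
  push_cast
  ring

theorem cast_C6 (c₄ c₆ l m : ℚ) :
    ((C6 c₄ c₆ l m : ℚ) : 𝕃) = C6 (c₄ : 𝕃) (c₆ : 𝕃) (l : 𝕃) (m : 𝕃) := by
  simp only [C6, C4l, C4m, Dl, Dm, Dll, Dlm, Dmm, Dlll, Dllm, Dlmm, Dmmm]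
  push_cast
  ring

/-- **S4 · isElliptic_sbase (S).** `Δ(sbase A B) = 2⁶3⁹5¹²(A³ − B²)`. -/
theorem isElliptic_sbase_iff (A B : ℚ) : (sbase A B).IsElliptic ↔ A ^ 3 ≠ B ^ 2 := by
  sorry

/-- **L5 · segmentFrame_fisher (S/M).** Fisher's segment is framed: at a good rational `t` the model is
`W_t := sbase (𝔠₄(c₄,c₆; 1−t+tl, tm)) (𝔠₆(…))` — elliptic by S4 + the syzygy
(`𝔠₄³ − 𝔠₆² = (c₄³−c₆²)𝔇⁵`, or `klein_syzygy` at `v_t` + L84), a Klein model by `seg_eq_Mv`, L84-C4,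
**L84-C6**, `cast_C4/cast_C6`. -/
theorem segmentFrame_fisher (T : SectionTable) (hT : T.Certified) (h86 : L84C6) {z a b : 𝕃}
    (hz : z ^ 4 + z ^ 3 + z ^ 2 + z + 1 = 0) (c₄ c₆ l m : ℚ) (h4 : kC4 a b = c₄)
    (h6 : kC6 a b = c₆) (hD : kD a b ≠ 0) :
    SegmentFrame T z a b (Mv1 a b (l : 𝕃) (m : 𝕃)) (Mv2 a b (l : 𝕃) (m : 𝕃)) := by
  sorry

/-- **ASSEMBLY · thm132_of_rigidity (S given the above).** F1 from a certified table and L84-C6: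
WLOG `E' ` elliptic forces `𝔇(l,m) ≠ 0`; torsor point `v` for `(c₄, c₆)` (T1, `c₄³ ≠ c₆²` from
`E.IsElliptic`); `ζ` exists in `ℚ̄` (`IsAlgClosed.exists_root` of `Φ₅`); L5 frames the segment;
L4 with `W₀ = sbase c₄ c₆`, `W₁ = sbase (𝔠₄(l,m)) (𝔠₆(l,m))` (Klein models by `h4,h6` / L84,
`D^{Kl}(w) = 𝔇(l,m)·D^{Kl}(v) ≠ 0`) gives `Congr W₁ W₀`; finally `E = ⟨5,0,0,0⟩⁻¹…`:
`congr_of_smul_eq _ (scale_smul_short 5 …)` on both sides + `congr_trans/congr_symm`. -/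
theorem thm132_of_rigidity (T : SectionTable) (hT : T.Certified) (h86 : L84C6) :
    thm132_geomTorsionFive_of_hesseFamily := by
  sorry

/-- **THE STUB.** With g11's kernel-checked road `CDT_three_five_switch_of_thm132 : F1 →
CDT_three_five_switch` (file `STUB_IDEAS_stub_switch_3g11_Road.lean`, 0 sorries; crux workfiles do not
import each other, so it enters as the hypothesis `road`) and `stub_switch ↔ CDT_three_five_switch`
(`Iff.rfl`, `Lines/Sketch.lean`), the registered stub follows from P0 + L84-C6 + L1–L5. -/
theorem stub_switch_of_rigidity
    (road : thm132_geomTorsionFive_of_hesseFamily → CDT_three_five_switch)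
    (hT : ∃ T : SectionTable, T.Certified) (h86 : L84C6) : CDT_three_five_switch := by
  obtain ⟨T, hT⟩ := hT
  exact road (thm132_of_rigidity T hT h86)

end Summit.ABC.ABC.Cruxes.FreyModularity.StubSwitchK3g12
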